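import Literature.MathematicalPhysics.QuantumFieldTheory.Sweep1ChatterjeeFreeEnergyProofs
import Summits.QuantumFields.YangMills.Theorems.EquipartitionCriticalityFreeEnergyLogCoefficientDefs
import HarnessLib

/-!
# Gaussian factorisation over the `D` coordinates and the logarithmic one-box bounds — crux `FreeEnergyLogCoefficient`, line Sketch, stub `logBounds` (Chatterjee §15/§17, Lemmas 17.2, 17.6)

Port of the tree's `ChatterjeeGaussianFactorisation` (`U(N)`, Lie-algebra configurations with values
in `ℝ^{N²}`) to configurations with values in `ℝ^D`: `maxwellV_eq_sum_formM` (the `ℝ^D`-valued lattice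
Maxwell action is the sum over the `D` coordinates of the scalar axial-gauge Maxwell forms
`LatticeMaxwell.formM`), `measurePreserving_cols` (the transport to `D`-tuples of scalar
configurations preserves Lebesgue measure), `lintegral_exp_maxwellV` (`∫ e^{-½M_n} = Z_M(B_n)^D`),
`lintegral_exp_beta_maxwellV` (scaling), `le_setLIntegral_exp_beta_maxwellV` (the cube version), and
`stub_logBounds`: the logarithms of the two Gaussian sandwich inequalities (Lemmas 17.2/17.6 up to the
Gaussian integral) are the one-box bounds `upper`/`lower` of the abstract joint limit.

Reference: S. Chatterjee, *The leading term of the Yang–Mills free energy*, J. Funct. Anal. 271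
(2016) 2944–3005, arXiv:1602.01222, §15, §17 (Lemmas 17.2, 17.6). [arXiv160201222]
-/

noncomputable section

open scoped Matrix Matrix.Norms.Frobenius ENNReal NNReal
open MeasureTheory Measure Filter Topology Set
open Literature.Probability.LatticeModels Literature.MathematicalPhysics.QuantumLattice
open Literature.MathematicalPhysics.QuantumFieldTheory

namespace Summit.QuantumFields.YangMills.Theorems.FreeEnergyLogCoefficient

open ChatterjeeAssembly AxialGauge WilsonWeakCoupling GaussianToolkit LatticeMaxwell

/-! ### The `ℝ^D`-valued Maxwell action is a sum of `D` scalar Maxwell forms -/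

section Factorisation

variable {d n D : ℕ}

/-- Coordinates of the zero extension are the glued scalar coordinate configurations (index sets
identified by `ChatterjeeAssembly.idx`). [folklore] -/
theorem zeroExtV_apply_coord (a : FreeIdx d n → EuclideanSpace ℝ (Fin D))
    (e : Literature.MathematicalPhysics.QuantumFieldTheory.ZdEdge d) (k : Fin D) :
    zeroExtV a e k = LatticeMaxwell.glue (pin := pinI (d := d)) (0 : Site d) n 0 (fun e' => a ((idx n).symm e') k) e := by
  unfold zeroExtV LatticeMaxwell.glue
  by_cases h : e ∈ boxEdges d n
  · by_cases hc : IsComb e <;> simp [h, mem_boxEdgesAt_zero.2 h, hc, pinI, idx]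
  · simp [h, mt mem_boxEdgesAt_zero.1 h]

/-- **The `ℝ^D`-valued Maxwell action is the sum over the `D` coordinates of the scalar Maxwell forms
of the coordinate configurations**: `M_n(H) = Σ_{k<D} M_n(H^k)`. [cite: arXiv160201222, §17 (proof of Lemma 17.2)] -/
theorem maxwellV_eq_sum_formM (a : FreeIdx d n → EuclideanSpace ℝ (Fin D)) :
    maxwellV d n a = ∑ k : Fin D, formM (pinI (d := d)) (0 : Site d) n 0 (fun e' => a ((idx n).symm e') k) := by
  unfold maxwellV formM
  rw [Finset.sum_comm]
  refine Finset.sum_congr rfl fun p _ => ?_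
  rw [EuclideanSpace.real_norm_sq_eq]
  refine Finset.sum_congr rfl fun k _ => ?_
  simp only [shift_zero, circV, sCirc, PiLp.sub_apply, PiLp.add_apply, zeroExtV_apply_coord]

/-- Scaling of the zero extension. [folklore] -/
theorem zeroExtV_smul (r : ℝ) (a : FreeIdx d n → EuclideanSpace ℝ (Fin D))
    (e : Literature.MathematicalPhysics.QuantumFieldTheory.ZdEdge d) :
    zeroExtV (r • a) e = r • zeroExtV a e := by
  unfold zeroExtV
  split_ifs <;> simp

/-- **The Maxwell action is a quadratic form**: `M(rH) = r² M(H)`. [folklore] -/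
theorem maxwellV_smul (r : ℝ) (a : FreeIdx d n → EuclideanSpace ℝ (Fin D)) :
    maxwellV d n (r • a) = r ^ 2 * maxwellV d n a := by
  unfold maxwellV
  rw [Finset.mul_sum]
  refine Finset.sum_congr rfl fun p _ => ?_
  have : circV (zeroExtV (r • a)) p = r • circV (zeroExtV a) p := by
    simp only [circV, zeroExtV_smul, smul_add, smul_sub]
  rw [this, norm_smul, mul_pow, Real.norm_eq_abs, sq_abs]

variable (n D)

/-- `maxwellV` is continuous in the configuration. [folklore] -/
theorem continuous_maxwellV : Continuous (maxwellV d n : (FreeIdx d n → EuclideanSpace ℝ (Fin D)) → ℝ) := by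
  rw [show (maxwellV d n : (FreeIdx d n → EuclideanSpace ℝ (Fin D)) → ℝ) = fun a =>
      ∑ k : Fin D, formM (pinI (d := d)) (0 : Site d) n 0 (fun e' => a ((idx n).symm e') k) from
    funext maxwellV_eq_sum_formM]
  exact continuous_finsetSum _ fun k _ => (continuous_formM _).comp (by fun_prop)

/-- **The coordinate transport preserves Lebesgue measure**: `a ↦ (k ↦ (e ↦ a_e^k))`, from `ℝ^D`-valued
configurations on `E_n^1` to `D`-tuples of scalar configurations, is `ofLp` in each factor followed by
a transposition (`ChatterjeeAssembly.measurePreserving_transpose`) and a reindexing. [folklore] -/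
theorem measurePreserving_cols :
    MeasurePreserving (fun (a : FreeIdx d n → EuclideanSpace ℝ (Fin D)) (k : Fin D)
      (e' : Free (pinI (d := d)) (0 : Site d) n) => a ((idx n).symm e') k) volume volume := by
  have h : MeasurePreserving
      ((fun (b : Fin D → FreeIdx d n → ℝ) (k : Fin D) => MeasurableEquiv.piCongrLeft (fun _ => ℝ) (idx n) (b k)) ∘
        (transposeCL (FreeIdx d n) (Fin D)) ∘
        (fun (a : FreeIdx d n → EuclideanSpace ℝ (Fin D)) (e : FreeIdx d n) => WithLp.ofLp (a e))) volume volume :=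
    ((volume_preserving_pi fun _ : Fin D => volume_measurePreserving_piCongrLeft (fun _ => ℝ) (idx n)).comp
      (measurePreserving_transpose (FreeIdx d n) (Fin D))).comp
      (volume_preserving_pi fun _ : FreeIdx d n => PiLp.volume_preserving_ofLp (Fin D))
  convert h using 1
  funext a k e'
  simp only [Function.comp_apply, piCongrLeft_const_apply, transposeCL_apply]

variable {n D}

/-- The `ℝ^D`-valued Gaussian weight is the product of the scalar weights of the coordinates. [cite: arXiv160201222, §17 (proof of Lemma 17.2)] -/
theorem ofReal_exp_maxwellV (a : FreeIdx d n → EuclideanSpace ℝ (Fin D)) :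
    ENNReal.ofReal (Real.exp (-(maxwellV d n a) / 2)) = ∏ k : Fin D, wM n (fun e' => a ((idx n).symm e') k) := by
  unfold wM
  rw [← ENNReal.ofReal_prod_of_nonneg (fun _ _ => (Real.exp_pos _).le), ← Real.exp_sum]
  congr 1
  rw [maxwellV_eq_sum_formM, ← Finset.sum_neg_distrib, Finset.sum_div]

/-- **Gaussian factorisation**: `∫ e^{-½M_n(H)} dH = Z_M(B_n)^D`. [cite: arXiv160201222, §17 (proof of Lemma 17.2)] -/
theorem lintegral_exp_maxwellV :
    ∫⁻ a : FreeIdx d n → EuclideanSpace ℝ (Fin D), ENNReal.ofReal (Real.exp (-(maxwellV d n a) / 2)) =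
      ZM (d := d) n ^ D := by
  simp_rw [ofReal_exp_maxwellV]
  have h := (measurePreserving_cols (d := d) n D).lintegral_comp (f := fun T => ∏ k, wM n (T k))
    (Finset.measurable_prod _ fun k _ => measurable_wM.comp (measurable_pi_apply k))
  rw [h, volume_pi, lintegral_fintype_prod_eq_prod _ (fun _ => measurable_wM)]
  simp only [lintegral_wM, Finset.prod_const, Finset.card_univ, Fintype.card_fin]

/-- **Scaling**: `∫ e^{-½βM_n(H)} dH = β^{-D|E_n^1|/2} Z_M(B_n)^D` for `β > 0`. [cite: arXiv160201222, §17 (proof of Lemma 17.2)] -/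
theorem lintegral_exp_beta_maxwellV {β : ℝ} (hβ : 0 < β) :
    ∫⁻ a : FreeIdx d n → EuclideanSpace ℝ (Fin D), ENNReal.ofReal (Real.exp (-β * maxwellV d n a / 2)) =
      ENNReal.ofReal ((Real.sqrt β ^ (Fintype.card (FreeIdx d n) * D))⁻¹) * ZM (d := d) n ^ D := by
  have hsq : 0 < Real.sqrt β := Real.sqrt_pos.2 hβ
  have hscale : ∀ a : FreeIdx d n → EuclideanSpace ℝ (Fin D), Real.exp (-β * maxwellV d n a / 2) =
      Real.exp (-(maxwellV d n (Real.sqrt β • a)) / 2) := fun a => by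
    rw [maxwellV_smul, Real.sq_sqrt hβ.le]; ring_nf
  simp_rw [hscale]
  have hfin : Module.finrank ℝ (FreeIdx d n → EuclideanSpace ℝ (Fin D)) = Fintype.card (FreeIdx d n) * D := by
    rw [Module.finrank_pi_fintype, Finset.sum_const, Finset.card_univ, finrank_euclideanSpace_fin, smul_eq_mul]
  rw [lintegral_comp_smul volume
      (fun a : FreeIdx d n → EuclideanSpace ℝ (Fin D) => ENNReal.ofReal (Real.exp (-(maxwellV d n a) / 2))) hsq.ne',
    lintegral_exp_maxwellV, hfin, abs_of_pos (by positivity)]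

/-- Vectors with small coordinates have small norm: `(∀ k, |v_k| ≤ ρ) ⇒ ‖v‖ ≤ Dρ` on `ℝ^D`. [folklore] -/
theorem norm_le_of_coord_le {v : EuclideanSpace ℝ (Fin D)} {ρ : ℝ} (hρ : 0 ≤ ρ) (h : ∀ k, |v k| ≤ ρ) :
    ‖v‖ ≤ D * ρ := by
  have hD : (D : ℝ) * ρ ^ 2 ≤ (D * ρ) ^ 2 := by
    have : (D : ℝ) ≤ (D : ℝ) ^ 2 := by exact_mod_cast Nat.le_self_pow two_ne_zero D
    nlinarith [sq_nonneg ρ]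
  refine (abs_le_of_sq_le_sq' ?_ (by positivity)).2
  rw [EuclideanSpace.real_norm_sq_eq]
  refine le_trans (Finset.sum_le_sum fun k _ => sq_le_sq' (abs_le.1 (h k)).1 (abs_le.1 (h k)).2) ?_
  simpa using hD

/-- **Gaussian factorisation on cubes**: for `β > 0`, `r ≥ 0`,
`β^{-D|E_n^1|/2} (Z_M(B_n) τ_n(|t|_∞ ≤ √β r/max(D,1)))^D ≤ ∫_{‖H_e‖ ≤ r} e^{-½βM_n(H)} dH`. [cite: arXiv160201222, §17 (proof of Lemma 17.6)] -/
theorem le_setLIntegral_exp_beta_maxwellV {β : ℝ} (hβ : 0 < β) {r : ℝ} (hr : 0 ≤ r) :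
    ENNReal.ofReal ((Real.sqrt β ^ (Fintype.card (FreeIdx d n) * D))⁻¹) *
        (ZM (d := d) n * LatticeMaxwell.τ (pinI (d := d)) (0 : Site d) n
          {y | ∀ e, |y e| ≤ Real.sqrt β * r / max (D : ℝ) 1}) ^ D ≤
      ∫⁻ a in Set.pi Set.univ (fun _ : FreeIdx d n => Metric.closedBall (0 : EuclideanSpace ℝ (Fin D)) r),
        ENNReal.ofReal (Real.exp (-β * maxwellV d n a / 2)) := by
  have hsq : 0 < Real.sqrt β := Real.sqrt_pos.2 hβ
  have hm : (0 : ℝ) < max (D : ℝ) 1 := lt_max_of_lt_right one_pos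
  set R := Real.sqrt β * r / max (D : ℝ) 1 with hR
  have hR0 : 0 ≤ R := by positivity
  set S := Set.pi Set.univ (fun _ : FreeIdx d n => Metric.closedBall (0 : EuclideanSpace ℝ (Fin D)) r) with hS
  set S' := {x : FreeIdx d n → EuclideanSpace ℝ (Fin D) | ∀ e, ‖x e‖ ≤ Real.sqrt β * r} with hS'
  set g := fun a : FreeIdx d n → EuclideanSpace ℝ (Fin D) => ENNReal.ofReal (Real.exp (-(maxwellV d n a) / 2)) with hg
  have hS'm : MeasurableSet S' := by
    have : S' = ⋂ e, {x : FreeIdx d n → EuclideanSpace ℝ (Fin D) | ‖x e‖ ≤ Real.sqrt β * r} := by ext; simp [hS']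
    rw [this]; exact MeasurableSet.iInter fun e => measurableSet_le (by fun_prop) measurable_const
  -- rescale: `1_S(a) e^{-½βM(a)} = (1_{S'} g)(√β a)`
  have hresc : ∀ a : FreeIdx d n → EuclideanSpace ℝ (Fin D),
      S.indicator (fun a => ENNReal.ofReal (Real.exp (-β * maxwellV d n a / 2))) a = S'.indicator g (Real.sqrt β • a) := by
    intro a
    have hmem : a ∈ S ↔ Real.sqrt β • a ∈ S' := by
      simp only [hS, hS', Set.mem_pi, Set.mem_univ, forall_true_left, mem_closedBall_zero_iff, Set.mem_setOf_eq,
        Pi.smul_apply, norm_smul, Real.norm_eq_abs, abs_of_pos hsq]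
      exact ⟨fun h e => mul_le_mul_of_nonneg_left (h e) hsq.le, fun h e => le_of_mul_le_mul_left (h e) hsq⟩
    by_cases ha : a ∈ S
    · rw [Set.indicator_of_mem ha, Set.indicator_of_mem (hmem.1 ha), hg]
      dsimp only
      rw [maxwellV_smul, Real.sq_sqrt hβ.le]; ring_nf
    · rw [Set.indicator_of_notMem ha, Set.indicator_of_notMem (fun h => ha (hmem.2 h))]
  have hSm : MeasurableSet S := MeasurableSet.univ_pi fun _ => Metric.isClosed_closedBall.measurableSet
  rw [← lintegral_indicator hSm]
  simp_rw [hresc]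
  have hfin : Module.finrank ℝ (FreeIdx d n → EuclideanSpace ℝ (Fin D)) = Fintype.card (FreeIdx d n) * D := by
    rw [Module.finrank_pi_fintype, Finset.sum_const, Finset.card_univ, finrank_euclideanSpace_fin, smul_eq_mul]
  rw [lintegral_comp_smul volume (S'.indicator g) hsq.ne', hfin, abs_of_pos (by positivity), lintegral_indicator hS'm]
  gcongr
  -- the box `B = cols ⁻¹' cube^D ⊆ S'`
  set cube : Set (Free (pinI (d := d)) (0 : Site d) n → ℝ) := {t | ∀ e, |t e| ≤ R} with hcube
  have hcubem : MeasurableSet cube := by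
    have : cube = ⋂ e, {t : Free (pinI (d := d)) (0 : Site d) n → ℝ | |t e| ≤ R} := by ext; simp [hcube]
    rw [this]; exact MeasurableSet.iInter fun e => measurableSet_le (by fun_prop) measurable_const
  set B := {x : FreeIdx d n → EuclideanSpace ℝ (Fin D) | ∀ k : Fin D, (fun e' => x ((idx n).symm e') k) ∈ cube} with hB
  have hBS' : B ⊆ S' := by
    intro x hx e
    have h' : ∀ k, |x e k| ≤ R := fun k => by simpa using hx k ((idx n) e)
    calc ‖x e‖ ≤ D * R := norm_le_of_coord_le hR0 h'
      _ ≤ max (D : ℝ) 1 * R := mul_le_mul_of_nonneg_right (le_max_left _ _) hR0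
      _ = Real.sqrt β * r := by rw [hR, mul_div_cancel₀ _ hm.ne']
  have hBm : MeasurableSet B := by
    rw [show B = (fun (x : FreeIdx d n → EuclideanSpace ℝ (Fin D)) (k : Fin D)
        (e' : Free (pinI (d := d)) (0 : Site d) n) => x ((idx n).symm e') k) ⁻¹' Set.pi Set.univ (fun _ => cube) by
      ext; simp [hB]]
    exact (measurePreserving_cols (d := d) n D).measurable (MeasurableSet.univ_pi fun _ => hcubem)
  calc (ZM (d := d) n * LatticeMaxwell.τ (pinI (d := d)) (0 : Site d) n {y | ∀ e, |y e| ≤ Real.sqrt β * r / max (D : ℝ) 1}) ^ D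
      = ∏ _k : Fin D, ∫⁻ t, cube.indicator (wM n) t := by
        rw [Finset.prod_const, Finset.card_univ, Fintype.card_fin, lintegral_indicator hcubem, setLIntegral_wM _ hcubem]
        rfl
    _ = ∫⁻ T : Fin D → (Free (pinI (d := d)) (0 : Site d) n → ℝ), ∏ k, cube.indicator (wM n) (T k) :=
        (lintegral_fintype_prod_eq_prod (fun _ : Fin D =>
          (volume : Measure (Free (pinI (d := d)) (0 : Site d) n → ℝ))) (fun _ => measurable_wM.indicator hcubem)).symm
    _ = ∫⁻ x : FreeIdx d n → EuclideanSpace ℝ (Fin D), ∏ k, cube.indicator (wM n) (fun e' => x ((idx n).symm e') k) :=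
        ((measurePreserving_cols (d := d) n D).lintegral_comp
          (Finset.measurable_prod _ fun k _ => (measurable_wM.indicator hcubem).comp (measurable_pi_apply k))).symm
    _ = ∫⁻ x in B, g x := by
        rw [← lintegral_indicator hBm]
        refine lintegral_congr fun x => ?_
        by_cases hx : x ∈ B
        · rw [Set.indicator_of_mem hx, hg]
          dsimp only
          rw [ofReal_exp_maxwellV]
          exact Finset.prod_congr rfl fun k _ => Set.indicator_of_mem (hx k) _
        · rw [Set.indicator_of_notMem hx]
          simp only [hB, Set.mem_setOf_eq, not_forall] at hx
          obtain ⟨k, hk⟩ := hx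
          exact Finset.prod_eq_zero (Finset.mem_univ k) (Set.indicator_of_notMem hk _)
    _ ≤ ∫⁻ x in S', g x := lintegral_mono_set hBS'

end Factorisation

/-! ### Logarithmic form of the Gaussian bounds for `log Z(B_n, β)` -/

section Group

variable {d N : ℕ} {G : Type*} [Group G] [TopologicalSpace G] [IsTopologicalGroup G]
  [CompactSpace G] [MeasurableSpace G] [BorelSpace G]

/-- **STUB 6 — Gaussian factorisation over the `D` coordinates and the logarithmic one-box bounds
(Chatterjee §15/§17, Lemmas 17.2 and 17.6 in logarithmic form).** `M_n(H) = Σ_{k<D} M_n(H^k)`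
(`maxwellV` on `ℝ^D` is the sum of `D` scalar axial-gauge Maxwell forms), hence
`∫ e^{−βM_n/2} = β^{−D|E_n^1|/2} Z_M(B_n)^D` and the cube bound
`∫_{‖a_e‖≤r} e^{−βM_n/2} ≥ β^{−D|E_n^1|/2} (Z_M(B_n) τ_n(|y_e| ≤ √β r/max(D,1)))^D`; taking logarithms in
the two Gaussian sandwich inequalities gives the `upper`/`lower` fields of `OneBoxBounds`. Port of
`ChatterjeeAssembly.{maxwell_eq_sum_formM, lintegral_exp_maxwell, lintegral_exp_beta_maxwell,
le_setLIntegral_exp_beta_maxwell, logZ_le, le_logZ}` with `Fin N × Fin N ↦ Fin D` (the hypotheses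
`hd`, `hρ`, `hA`, `hC` of the registered interface are not needed). [cite: arXiv160201222, Lemmas 17.2, 17.6, §15] -/
theorem stub_logBounds [SecondCountableTopology G] (hd : 1 ≤ d) (ρ : G →* Matrix (Fin N) (Fin N) ℂ)
    (hρ : Continuous ρ) {D : ℕ} {A C cH r₁ : ℝ} (hA : 0 ≤ A) (hC : 0 < C) (hcH : 0 < cH) {κ : ℝ → ℝ}
    (hκ : ∀ r : ℝ, 0 ≤ r → r ≤ r₁ → 1 ≤ κ r)
    (hZ1 : ∀ (n : ℕ) (β : ℝ), 0 ≤ β → zdPartitionFunction ρ β (halfOpenBox d n) ≤ 1)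
    (h71 : ∀ (n : ℕ) (β : ℝ), 2 ≤ β →
      ENNReal.ofReal (Real.exp (-(C * n ^ d * Real.log β))) ≤ zdPartitionFunction ρ β (halfOpenBox d n))
    (hupZ : ∀ (n : ℕ) (β : ℝ), 1 ≤ n → 2 ≤ β → WilsonWeakCoupling.rho0 C d n β ≤ r₁ / 2 →
      zdPartitionFunction ρ β (halfOpenBox d n) ≤
        2 * (ENNReal.ofReal cH ^ Fintype.card (WilsonWeakCoupling.FreeIdx d n) *
          (ENNReal.ofReal (Real.exp (A * β * (2 * WilsonWeakCoupling.rho0 C d n β) ^ 3 *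
              (ChatterjeeAssembly.Pn d n : ℝ))) *
            ∫⁻ a : WilsonWeakCoupling.FreeIdx d n → EuclideanSpace ℝ (Fin D),
              ENNReal.ofReal (Real.exp (-β * maxwellV d n a / 2)))))
    (hlowZ : ∀ (n : ℕ) (β : ℝ), 1 ≤ n → 0 ≤ β → ∀ r : ℝ, 0 < r → r ≤ r₁ →
      ((ENNReal.ofReal (κ r ^ D))⁻¹ * ENNReal.ofReal cH) ^
            Fintype.card (WilsonWeakCoupling.FreeIdx d n) *
          (ENNReal.ofReal (Real.exp (-(A * β * r ^ 3 * (ChatterjeeAssembly.Pn d n : ℝ)))) *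
            ∫⁻ a in Set.pi Set.univ
                (fun _ : WilsonWeakCoupling.FreeIdx d n => Metric.closedBall (0 : EuclideanSpace ℝ (Fin D)) r),
              ENNReal.ofReal (Real.exp (-β * maxwellV d n a / 2))) ≤
        zdPartitionFunction ρ β (halfOpenBox d n)) :
    (∀ (n : ℕ) (β : ℝ), 1 ≤ n → 2 ≤ β → WilsonWeakCoupling.rho0 C d n β ≤ r₁ / 2 →
      Real.log (zdPartitionFunction ρ β (halfOpenBox d n)).toReal ≤
        Real.log 2 + (ChatterjeeAssembly.D₁ d n : ℝ) * Real.log cH +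
          A * β * (2 * WilsonWeakCoupling.rho0 C d n β) ^ 3 * (ChatterjeeAssembly.Pn d n : ℝ) -
          ((ChatterjeeAssembly.D₁ d n : ℝ) * (D : ℝ) / 2) * Real.log β +
          (D : ℝ) * ChatterjeeAssembly.logZM d n) ∧
    (∀ (n : ℕ) (β : ℝ), 1 ≤ n → 2 ≤ β → ∀ (r : ℝ), 0 < r → r ≤ r₁ → ∀ (L : ℝ≥0∞), L ≠ 0 →
      L ≤ LatticeMaxwell.τ (LatticeMaxwell.pinI (d := d)) (0 : Site d) n
        {y | ∀ e, |y e| ≤ Real.sqrt β * r / max (D : ℝ) 1} →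
      (ChatterjeeAssembly.D₁ d n : ℝ) * (Real.log cH - (D : ℝ) * Real.log (κ r)) -
          A * β * r ^ 3 * (ChatterjeeAssembly.Pn d n : ℝ) -
          ((ChatterjeeAssembly.D₁ d n : ℝ) * (D : ℝ) / 2) * Real.log β +
          (D : ℝ) * (ChatterjeeAssembly.logZM d n + Real.log L.toReal) ≤
        Real.log (zdPartitionFunction ρ β (halfOpenBox d n)).toReal) := by
  -- `hd`, `hρ`, `hA`, `hC` belong to the registered interface but are not used in this step
  have _ := hd; have _ := hρ; have _ := hA; have _ := hC
  -- `Z(B_n, β) ≠ ∞` (`Z ≤ 1`) and `Z(B_n, β).toReal > 0` for `β ≥ 2` (Theorem 7.1)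
  have hZtop : ∀ (n : ℕ) (β : ℝ), 0 ≤ β → zdPartitionFunction ρ β (halfOpenBox d n) ≠ ∞ := fun n β hβ =>
    ne_top_of_le_ne_top ENNReal.one_ne_top (hZ1 n β hβ)
  have hZpos : ∀ (n : ℕ) (β : ℝ), 2 ≤ β → 0 < (zdPartitionFunction ρ β (halfOpenBox d n)).toReal := fun n β hβ =>
    ENNReal.toReal_pos (lt_of_lt_of_le (ENNReal.ofReal_pos.2 (Real.exp_pos _)) (h71 n β hβ)).ne'
      (hZtop n β (by linarith))
  refine ⟨fun n β hn hβ hρ0 => ?_, fun n β hn hβ r hr hr1 L hL0 hL => ?_⟩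
  · -- Lemma 17.2 in logarithmic form
    have hβ0 : 0 < β := by linarith
    have h := hupZ n β hn hβ hρ0
    rw [lintegral_exp_beta_maxwellV hβ0] at h
    have hZMtop := (ZM_ne_zero_and_ne_top (d := d) (n := n)).2
    set T := A * β * (2 * rho0 C d n β) ^ 3 * (Pn d n : ℝ) with hT
    set cβ := (Real.sqrt β ^ (Fintype.card (FreeIdx d n) * D))⁻¹ with hcβ
    have hcβpos : 0 < cβ := by rw [hcβ]; positivity
    have hRtop : 2 * (ENNReal.ofReal cH ^ Fintype.card (FreeIdx d n) *
        (ENNReal.ofReal (Real.exp T) * (ENNReal.ofReal cβ * ZM (d := d) n ^ D))) ≠ ∞ := by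
      apply ENNReal.mul_ne_top ENNReal.ofNat_ne_top
      apply ENNReal.mul_ne_top (ENNReal.pow_ne_top ENNReal.ofReal_ne_top)
      apply ENNReal.mul_ne_top ENNReal.ofReal_ne_top
      exact ENNReal.mul_ne_top ENNReal.ofReal_ne_top (ENNReal.pow_ne_top hZMtop)
    refine (Real.log_le_log (hZpos n β hβ) (ENNReal.toReal_mono hRtop h)).trans (le_of_eq ?_)
    rw [ENNReal.toReal_mul, ENNReal.toReal_mul, ENNReal.toReal_mul, ENNReal.toReal_mul, ENNReal.toReal_pow,
      ENNReal.toReal_pow, ENNReal.toReal_ofReal (Real.exp_pos _).le, ENNReal.toReal_ofReal hcβpos.le,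
      ENNReal.toReal_ofReal hcH.le, ENNReal.toReal_ofNat]
    have hZMr : 0 < (ZM (d := d) n).toReal := ZM_toReal_pos
    rw [Real.log_mul (by positivity) (by positivity), Real.log_mul (by positivity) (by positivity),
      Real.log_mul (by positivity) (by positivity), Real.log_mul (by positivity) (by positivity),
      Real.log_pow, Real.log_exp, Real.log_pow, hcβ, Real.log_inv, Real.log_pow, Real.log_sqrt hβ0.le]
    simp only [D₁, logZM, hT]
    push_cast
    ring
  · -- Lemma 17.6 in logarithmic form
    have hβ0 : 0 < β := by linarith
    have h := hlowZ n β hn hβ0.le r hr hr1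
    have hcube := le_setLIntegral_exp_beta_maxwellV (d := d) (n := n) (D := D) hβ0 hr.le
    have hLtop : L ≠ ∞ := ne_top_of_le_ne_top (measure_ne_top _ _) hL
    set cβ := (Real.sqrt β ^ (Fintype.card (FreeIdx d n) * D))⁻¹ with hcβ
    have hcβpos : 0 < cβ := by rw [hcβ]; positivity
    set T := A * β * r ^ 3 * (Pn d n : ℝ) with hT
    obtain ⟨lc, hlc⟩ : ∃ lc : ℝ≥0∞, lc = (ENNReal.ofReal (κ r ^ D))⁻¹ * ENNReal.ofReal cH := ⟨_, rfl⟩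
    rw [← hlc] at h
    -- chain the ENNReal inequalities
    have hchain : lc ^ Fintype.card (FreeIdx d n) * (ENNReal.ofReal (Real.exp (-T)) *
        (ENNReal.ofReal cβ * (ZM (d := d) n * L) ^ D)) ≤ zdPartitionFunction ρ β (halfOpenBox d n) := by
      refine le_trans ?_ h
      gcongr lc ^ Fintype.card (FreeIdx d n) * (ENNReal.ofReal (Real.exp (-T)) * ?_)
      exact le_trans (by gcongr) hcube
    have h2 := ENNReal.toReal_mono (hZtop n β hβ0.le) hchain
    have hκD : 0 < κ r ^ D := pow_pos (lt_of_lt_of_le one_pos (hκ r hr.le hr1)) D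
    have hlcpos : 0 < lc.toReal := by
      refine ENNReal.toReal_pos ?_ ?_ <;> rw [hlc]
      · exact mul_ne_zero (ENNReal.inv_ne_zero.2 ENNReal.ofReal_ne_top) (ENNReal.ofReal_pos.2 hcH).ne'
      · exact ENNReal.mul_ne_top (ENNReal.inv_ne_top.2 (ENNReal.ofReal_pos.2 hκD).ne') ENNReal.ofReal_ne_top
    have hLpos : 0 < L.toReal := ENNReal.toReal_pos hL0 hLtop
    have hZMr : 0 < (ZM (d := d) n).toReal := ZM_toReal_pos
    -- the real form of the left-hand side
    have hLHS : (lc ^ Fintype.card (FreeIdx d n) * (ENNReal.ofReal (Real.exp (-T)) *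
        (ENNReal.ofReal cβ * (ZM (d := d) n * L) ^ D))).toReal =
        lc.toReal ^ Fintype.card (FreeIdx d n) * (Real.exp (-T) * (cβ * ((ZM (d := d) n).toReal * L.toReal) ^ D)) := by
      rw [ENNReal.toReal_mul, ENNReal.toReal_mul, ENNReal.toReal_mul, ENNReal.toReal_pow, ENNReal.toReal_pow,
        ENNReal.toReal_mul, ENNReal.toReal_ofReal (Real.exp_pos _).le, ENNReal.toReal_ofReal hcβpos.le]
    rw [hLHS] at h2
    have hpos : 0 < lc.toReal ^ Fintype.card (FreeIdx d n) *
        (Real.exp (-T) * (cβ * ((ZM (d := d) n).toReal * L.toReal) ^ D)) := by positivity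
    refine le_trans (le_of_eq ?_) (Real.log_le_log hpos h2)
    have hlc' : Real.log lc.toReal = Real.log cH - D * Real.log (κ r) := by
      rw [hlc, ENNReal.toReal_mul, ENNReal.toReal_inv, ENNReal.toReal_ofReal hκD.le, ENNReal.toReal_ofReal hcH.le,
        Real.log_mul (inv_ne_zero hκD.ne') hcH.ne', Real.log_inv, Real.log_pow]
      ring
    rw [Real.log_mul (by positivity) (by positivity), Real.log_mul (by positivity) (by positivity),
      Real.log_mul (by positivity) (by positivity), Real.log_pow, Real.log_pow,
      Real.log_mul (by positivity) (by positivity), Real.log_exp, hlc', hcβ, Real.log_inv, Real.log_pow,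
      Real.log_sqrt hβ0.le]
    simp only [D₁, logZM, hT]
    push_cast
    ring

end Group

end Summit.QuantumFields.YangMills.Theorems.FreeEnergyLogCoefficient

end
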